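import Literature.Algebra.Polynomial.CasasAlvero.CharThirteen
import Literature.Algebra.Polynomial.CasasAlvero.Degree11CharP
import Literature.Algebra.Polynomial.CasasAlvero.DigitReduction
import HarnessLib

/-!
# Casas-Alvero degrees in characteristic 13: everything except the digit `5`

`CharThirteen.lean` left the base-13 digits `5` and `11` undecided; `Degree11CharP.lean` removes `11`
(`X^11 - 6X^7 + 4X^5 + X^4 - 3X^2` is a Casas-Alvero polynomial over every field of characteristic `13`).  Hence in
characteristic `13` the Casas-Alvero degrees lie in `{0} ∪ {1,2,3,4,5}·13^k` and contain `{0} ∪ {1,2,3,4}·13^k`; and over a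
perfect field the classification is complete CONDITIONALLY on the single open digit `CA_5` (which holds according to the
bad-prime computation of [CastryckLaterveerOunaies2012, §2]: `13` is not among the bad primes `2, 3, 7, 11, 131, 193, 599,
3541, 8009` of degree `5` — since formalised: `Degree5.lean` proves `CA_5` over every field of good characteristic, and
`CharThirteenComplete.lean` discharges the condition; ERRATUM: earlier revisions wrote `1451` for `3541`).
-/

noncomputable section

open Polynomial

namespace Literature.Algebra.Polynomial.CasasAlvero

variable (K : Type*) [Field K] [CharP K 13]

/-- `¬ CA_{11·13^k}` in characteristic `13`. [folklore] -/
theorem not_holdsInDegree_eleven_mul_thirteen_pow (k : ℕ) : ¬ HoldsInDegree K (11 * 13 ^ k) := by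
  haveI : Fact (Nat.Prime 13) := ⟨by norm_num⟩
  exact not_holdsInDegree_mul_prime_pow 13 k (not_holdsInDegree_eleven_of_char_13 K)

/-- **characteristic 13, sharpened**: the Casas-Alvero degrees are among `{0} ∪ {1,2,3,4,5}·13^k`, and
`{0} ∪ {1,2,3,4}·13^k` are Casas-Alvero degrees; only the digit `5` is undecided. [cite: GrafVonBothmerEtAl2007, Props. 2, 6, 7]
[cite: CastryckLaterveerOunaies2012, §2] -/
theorem classification_char_thirteen_sharp (d : ℕ) :
    (HoldsInDegree K d → d = 0 ∨ ∃ k, d = 13 ^ k ∨ d = 2 * 13 ^ k ∨ d = 3 * 13 ^ k ∨ d = 4 * 13 ^ k ∨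
      d = 5 * 13 ^ k) ∧
    (d = 0 ∨ (∃ k, d = 13 ^ k ∨ d = 2 * 13 ^ k ∨ d = 3 * 13 ^ k ∨ d = 4 * 13 ^ k) → HoldsInDegree K d) := by
  obtain ⟨h₁, h₂⟩ := classification_char_thirteen K d
  refine ⟨fun h => ?_, h₂⟩
  rcases h₁ h with h0 | ⟨k, hk | hk | hk | hk | hk | hk⟩
  · exact Or.inl h0
  · exact Or.inr ⟨k, Or.inl hk⟩
  · exact Or.inr ⟨k, Or.inr (Or.inl hk)⟩
  · exact Or.inr ⟨k, Or.inr (Or.inr (Or.inl hk))⟩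
  · exact Or.inr ⟨k, Or.inr (Or.inr (Or.inr (Or.inl hk)))⟩
  · exact Or.inr ⟨k, Or.inr (Or.inr (Or.inr (Or.inr hk)))⟩
  · exact absurd (hk ▸ h) (not_holdsInDegree_eleven_mul_thirteen_pow K k)

/-- Over a perfect field of characteristic `13`, CONDITIONALLY on the one open digit `CA_5(K)`: the Casas-Alvero degrees
are exactly `{0} ∪ {1,2,3,4,5}·13^k`. [cite: GrafVonBothmerEtAl2007, Props. 2, 6, 7] [cite: CastryckLaterveerOunaies2012, §2] -/
theorem holdsInDegree_iff_char_thirteen_of_five [PerfectRing K 13] (h5 : HoldsInDegree K 5) (d : ℕ) :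
    HoldsInDegree K d ↔ d = 0 ∨ ∃ k, d = 13 ^ k ∨ d = 2 * 13 ^ k ∨ d = 3 * 13 ^ k ∨ d = 4 * 13 ^ k ∨
      d = 5 * 13 ^ k := by
  haveI : Fact (Nat.Prime 13) := ⟨by norm_num⟩
  refine ⟨(classification_char_thirteen_sharp K d).1, ?_⟩
  rintro (h0 | ⟨k, hk | hk | hk | hk | hk⟩)
  · exact (classification_char_thirteen_sharp K d).2 (Or.inl h0)
  · exact (classification_char_thirteen_sharp K d).2 (Or.inr ⟨k, Or.inl hk⟩)
  · exact (classification_char_thirteen_sharp K d).2 (Or.inr ⟨k, Or.inr (Or.inl hk)⟩)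
  · exact (classification_char_thirteen_sharp K d).2 (Or.inr ⟨k, Or.inr (Or.inr (Or.inl hk))⟩)
  · exact (classification_char_thirteen_sharp K d).2 (Or.inr ⟨k, Or.inr (Or.inr (Or.inr hk))⟩)
  · exact (holdsInDegree_iff_digit K 13 d).2 (Or.inr ⟨k, 5, by norm_num, by norm_num, hk, h5⟩)

end Literature.Algebra.Polynomial.CasasAlvero
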